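import Summits.ResolutionOfSingularities.ResolutionOfSingularities.Theorems.HilbertSamuelEliminationSigmaMaxModificationsCorridor3WLadderSegmentsNearLocusComponents
import Summits.ResolutionOfSingularities.ResolutionOfSingularities.Theorems.HilbertSamuelEliminationSigmaMaxModificationsCorridor3WLadderSegmentsExtract
import Summits.ResolutionOfSingularities.ResolutionOfSingularities.Theorems.HilbertSamuelEliminationSigmaMaxModificationsCorridor3WLadderRecognitionNearLocus
import Summits.ResolutionOfSingularities.ResolutionOfSingularities.Theorems.HilbertSamuelEliminationSigmaMaxModificationsCorridor3WLadderStrataLabels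
import HarnessLib

/-!
# [OURS · L1 W4.2] THE NEAR LOCUS OVER AN ISOLATED BASE AND THE LABELS IT CARRIES: clopenness, its components, and «ONE LABEL» along the steps
# of a unit (crux `SigmaMaxModifications` stmt-ResolutionOfSingularities-18506; conjunct `SigmaMaxModificationsCorridor3` stmt-…-19249; line `w_ladder`;
# RECOGNITION (R5) = (H-emp), label side)

Stub worker res-L1-w42-stub-1 (gen 4). Helper file `--supports stmt-ResolutionOfSingularities-19249 --as helper`; kernel only, FACT-FREE, no new
definition (the two geometric dichotomy hypotheses are spelled inline).

Along a chain `c` of canonical near steps from a maximal origin (admissible oracle, `ν ≠ Φ^{(N)}`), at a base `b` whose marked point `x_b` is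
isolated in its `ν`-stratum, write `N_n ⊆ X_{b+n}(ν)` for the near locus over `x_b` (`(upTower b).nearLocus N x_b n`). This file proves:

* §1 `N_n` is CLOPEN in the stratum: closed, and `N_n = X_{b+n}(ν) ∩ φ_n⁻¹(U)` for the isolating open `U ∋ x_b`; it contains `x_{b+n}`; its
  image under the blow-down lies in `N_{n-1}`.
* §2 its components: if `N_n` is irreducible it IS an irreducible component of the stratum and the only one inside it; if `N_n` is a finite set
  of closed points, each of its points is open in the stratum, a component `{y}` of it, and the components inside `N_n` are these singletons.
* §3 «ONE LABEL»: if all components of `X_{b+n}(ν)` inside `N_n` carry one label, a label part meeting `N_n` CONTAINS it (hence contains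
  `x_{b+n}`); and ONE LABEL PROPAGATES from `n` to `n + 1` along the canonical near step under the DICHOTOMY «`N` infinite irreducible, or a finite
  set of closed points» at both stages (CJS: the near locus over the point of a unit is a `ν`-line `≅ ℙ¹` or finitely many closed points,
  Lemma 6.33 / p. 105) — the dichotomy is a HYPOTHESIS here (recognition geometry, stub-2 / res-D-pv-038), consumed by name.

OURS bookkeeping; NOT a statement of the manuscript [Hironaka2017] nor of [CossartJannsenSaito2020]. AI-written; AI review is weaker than expert
review.

References: V. Cossart, U. Jannsen, S. Saito, LNM 2270 (2020), Rem. 6.29 (1), Lemma 6.33, Def. 6.34, Def. 6.38, p. 105 [CossartJannsenSaito2020].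
-/

noncomputable section

set_option linter.dupNamespace false -- namespace `…Corridor3.Moving` re-enters `…Corridor3` (module convention of the Moving files)

open CategoryTheory AlgebraicGeometry TopologicalSpace Topology IsLocalRing
open Literature.AlgebraicGeometry.Resolution Literature.RingTheory.HilbertSamuel
open Literature.AlgebraicGeometry.CossartJannsenSaito2020
open Summit.ResolutionOfSingularities.ResolutionOfSingularities.Theorems.CampaignW42
open Summit.ResolutionOfSingularities.ResolutionOfSingularities.Theorems.SigmaMaxModificationsCorridor3.Helpers

namespace Summit.ResolutionOfSingularities.ResolutionOfSingularities.Theorems.SigmaMaxModificationsCorridor3.Moving.Seg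

variable {R : ∀ S : Scheme.{0}, CentreSeq S → Prop} {N : ℕ} {ν : ℕ → ℕ} {k : Type} [Field k]
  {c : ℕ → MarkedStage.{0}} (hc : ∀ n, CanonicalNearStep R N ν (c n) (c (n + 1))) (hRa : OracleAdmissible R)
  (hν : ν ≠ iterPSum N Phi) (h0 : Helpers.CycleInv k N ν (c 0))
  {p : ℕ} {X : Scheme.{0}} [IsLocallyNoetherian X] {x : X} (hX : IsMaximalOrigin p N ν X x)
  (hreach : Reaches R N ν (MarkedStage.init X x) (c 0))

/-! ## §1. The near locus over an isolated base is clopen in the stratum -/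

include hX hreach in
/-- **The near locus lies in the stratum**: `N_n ⊆ X_{b+n}(ν)`. [cite: CossartJannsenSaito2020, Def. 6.38 (iii)] -/
theorem nearLocus_subset_hsStratum (b n : ℕ) :
    (upTower hc hRa hν h0 b).nearLocus N (c b).pt n ⊆ Scheme.hsStratum (c (b + n)).W N ν := by
  intro z hz
  refine Scheme.mem_hsStratum_iff.mpr ?_
  have h2 : Scheme.hsFun (c (b + n)).W N z = Scheme.hsFun (c b).W N (c b).pt := hz.2
  rw [h2, hsFun_pt hc hX hreach]

include hX hreach in
/-- **The marked point is a near point**: `x_{b+n} ∈ N_n`. [cite: CossartJannsenSaito2020, Def. 6.38 (vi)] -/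
theorem pt_mem_nearLocus (b n : ℕ) : (c (b + n)).pt ∈ (upTower hc hRa hν h0 b).nearLocus N (c b).pt n := by
  refine ⟨upTower_phi_pt hc hRa hν h0 b n, ?_⟩
  show Scheme.hsFun (c (b + n)).W N (c (b + n)).pt = Scheme.hsFun (c b).W N (c b).pt
  rw [hsFun_pt hc hX hreach, hsFun_pt hc hX hreach]

include hX hreach in
/-- **`N_n = X_{b+n}(ν) ∩ φ_n⁻¹(U)` for an isolating open `U ∋ x_b`** (`U ∩ X_b(ν) ⊆ {x_b}`): the near locus is OPEN in the stratum.
[cite: CossartJannsenSaito2020, Def. 6.38 (iii), Def. 13.3] -/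
theorem nearLocus_eq_hsStratum_inter_preimage (b : ℕ) {U : Set (c b).W} (hbU : (c b).pt ∈ U)
    (hUiso : U ∩ Scheme.hsStratum (c b).W N ν ⊆ {(c b).pt}) (n : ℕ) :
    (upTower hc hRa hν h0 b).nearLocus N (c b).pt n =
      Scheme.hsStratum (c (b + n)).W N ν ∩ ((upTower hc hRa hν h0 b).phi n).base ⁻¹' U := by
  ext z
  constructor
  · intro hz
    exact ⟨nearLocus_subset_hsStratum hc hRa hν h0 hX hreach b n hz, by rw [Set.mem_preimage, hz.1]; exact hbU⟩
  · rintro ⟨hzY, hzU⟩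
    have hφ : ((upTower hc hRa hν h0 b).phi n).base z = (c b).pt :=
      hUiso ⟨hzU, phi_mem_hsStratum hc hRa hν h0 hX hreach b n z hzY⟩
    refine ⟨hφ, ?_⟩
    show Scheme.hsFun (c (b + n)).W N z = Scheme.hsFun (c b).W N (c b).pt
    rw [Scheme.mem_hsStratum_iff.mp hzY, hsFun_pt hc hX hreach]

include hc hRa hν h0 in
/-- The stratum `X_n(ν)` is closed along the chain. [cite: CossartJannsenSaito2020, Lemma 2.36] -/
theorem isClosed_hsStratum_at (n : ℕ) : IsClosed (Scheme.hsStratum (c n).W N ν) := by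
  have hcyc : Helpers.CycleInv k N ν (c n) := cycleInv_at hc hRa hν h0 n
  rw [hsStratum_eq_hsStratumGE_of_supMax hcyc.2.2.2.1]
  exact isClosed_hsStratumGE_of_cycleInv hcyc ν

include hX hreach in
/-- **The near locus is closed.** [cite: CossartJannsenSaito2020, Def. 6.38 (iii)] -/
theorem isClosed_nearLocus (b n : ℕ) : IsClosed ((upTower hc hRa hν h0 b).nearLocus N (c b).pt n) := by
  have hclosed : IsClosed ({(c b).pt} : Set (c b).W) := Reaches.isClosed_pt hX.isClosed (reaches_chain hreach hc b)
  have heq : (upTower hc hRa hν h0 b).nearLocus N (c b).pt n =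
      ((upTower hc hRa hν h0 b).phi n).base ⁻¹' {(c b).pt} ∩ Scheme.hsStratum (c (b + n)).W N ν := by
    ext z
    constructor
    · intro hz; exact ⟨hz.1, nearLocus_subset_hsStratum hc hRa hν h0 hX hreach b n hz⟩
    · rintro ⟨hz1, hz2⟩
      refine ⟨hz1, ?_⟩
      show Scheme.hsFun (c (b + n)).W N z = Scheme.hsFun (c b).W N (c b).pt
      rw [Scheme.mem_hsStratum_iff.mp hz2, hsFun_pt hc hX hreach]
  rw [heq]
  exact (hclosed.preimage ((upTower hc hRa hν h0 b).phi n).continuous).inter (isClosed_hsStratum_at hc hRa hν h0 (b + n))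

/-- **The blow-down maps `N_{n+1}` into `N_n`.** [cite: CossartJannsenSaito2020, Def. 6.34 (ii), Thm. 3.10 (1)] -/
theorem image_nearLocus_succ_subset (b n : ℕ) :
    ((upTower hc hRa hν h0 b).π n).base '' (upTower hc hRa hν h0 b).nearLocus N (c b).pt (n + 1) ⊆
      (upTower hc hRa hν h0 b).nearLocus N (c b).pt n :=
  BlowupTowerNear.nearLocus_succ_subset _ (keySetting_upTower hc hRa hν h0 b) (isPermissible_centreIdeal_upTower hc hRa hν h0 b) _ n

/-! ## §2. The components of the stratum inside the near locus -/

include hX hreach in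
/-- **If `N_n` is irreducible it IS an irreducible component of `X_{b+n}(ν)`** (it is a union of components: maximality).
[cite: CossartJannsenSaito2020, Rem. 6.29 (1)] -/
theorem nearLocus_mem_componentsIn_of_isIrreducible (b : ℕ)
    (hU : ∃ U : Set (c b).W, IsOpen U ∧ (c b).pt ∈ U ∧ U ∩ Scheme.hsStratum (c b).W N ν ⊆ {(c b).pt}) (n : ℕ)
    (hirr : IsIrreducible ((upTower hc hRa hν h0 b).nearLocus N (c b).pt n)) :
    (upTower hc hRa hν h0 b).nearLocus N (c b).pt n ∈ componentsIn (Scheme.hsStratum (c (b + n)).W N ν) := by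
  refine mem_componentsIn_iff.mpr ⟨nearLocus_subset_hsStratum hc hRa hν h0 hX hreach b n, hirr, fun T hTY hT hNT => ?_⟩
  exact subset_nearLocus_of_isIrreducible_of_meets hc hRa hν h0 hX hreach b hU n hT hTY
    ⟨(c (b + n)).pt, hNT (pt_mem_nearLocus hc hRa hν h0 hX hreach b n), pt_mem_nearLocus hc hRa hν h0 hX hreach b n⟩

include hX hreach in
/-- … and it is the ONLY component of the stratum inside it. [folklore] -/
theorem eq_nearLocus_of_mem_componentsIn_of_isIrreducible (b : ℕ)
    (hU : ∃ U : Set (c b).W, IsOpen U ∧ (c b).pt ∈ U ∧ U ∩ Scheme.hsStratum (c b).W N ν ⊆ {(c b).pt}) (n : ℕ)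
    (hirr : IsIrreducible ((upTower hc hRa hν h0 b).nearLocus N (c b).pt n)) {Z : Set (c (b + n)).W}
    (hZ : Z ∈ componentsIn (Scheme.hsStratum (c (b + n)).W N ν)) (hZN : Z ⊆ (upTower hc hRa hν h0 b).nearLocus N (c b).pt n) :
    Z = (upTower hc hRa hν h0 b).nearLocus N (c b).pt n := by
  by_contra hne
  exact not_subset_of_mem_componentsIn_of_ne (nearLocus_mem_componentsIn_of_isIrreducible hc hRa hν h0 hX hreach b hU n hirr) hZ hne hZN

include hX hreach in
/-- **In a near locus consisting of finitely many closed points, every point is OPEN in the stratum**: `{y} = X_{b+n}(ν) ∩ O` for an open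
`O`. [folklore] -/
theorem exists_isOpen_inter_hsStratum_eq_singleton (b : ℕ)
    (hU : ∃ U : Set (c b).W, IsOpen U ∧ (c b).pt ∈ U ∧ U ∩ Scheme.hsStratum (c b).W N ν ⊆ {(c b).pt}) (n : ℕ)
    (hfin : ((upTower hc hRa hν h0 b).nearLocus N (c b).pt n).Finite)
    (hcl : ∀ y ∈ (upTower hc hRa hν h0 b).nearLocus N (c b).pt n, IsClosed ({y} : Set (c (b + n)).W))
    {y : (c (b + n)).W} (hy : y ∈ (upTower hc hRa hν h0 b).nearLocus N (c b).pt n) :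
    ∃ O : Set (c (b + n)).W, IsOpen O ∧ O ∩ Scheme.hsStratum (c (b + n)).W N ν = {y} := by
  obtain ⟨U, hUo, hbU, hUiso⟩ := hU
  have hrest : IsClosed ((upTower hc hRa hν h0 b).nearLocus N (c b).pt n \ {y}) := by
    have : (upTower hc hRa hν h0 b).nearLocus N (c b).pt n \ {y} = ⋃ w ∈ (upTower hc hRa hν h0 b).nearLocus N (c b).pt n \ {y}, {w} :=
      (Set.biUnion_of_singleton _).symm
    rw [this]
    exact (hfin.subset Set.sdiff_subset).isClosed_biUnion fun w hw => hcl w hw.1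
  refine ⟨((upTower hc hRa hν h0 b).phi n).base ⁻¹' U ∩ ((upTower hc hRa hν h0 b).nearLocus N (c b).pt n \ {y})ᶜ,
    (hUo.preimage ((upTower hc hRa hν h0 b).phi n).continuous).inter hrest.isOpen_compl, ?_⟩
  ext z
  constructor
  · rintro ⟨⟨hzU, hzc⟩, hzY⟩
    have hzN : z ∈ (upTower hc hRa hν h0 b).nearLocus N (c b).pt n := by
      rw [nearLocus_eq_hsStratum_inter_preimage hc hRa hν h0 hX hreach b hbU hUiso n]; exact ⟨hzY, hzU⟩
    by_contra hzy
    exact hzc ⟨hzN, hzy⟩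
  · rintro rfl
    refine ⟨⟨?_, fun h => h.2 rfl⟩, nearLocus_subset_hsStratum hc hRa hν h0 hX hreach b n hy⟩
    rw [Set.mem_preimage, hy.1]; exact hbU

/-- An irreducible subset of `Y` meeting an open set `O` with `O ∩ Y = {y}`, `y` closed, is `{y}`. [folklore] -/
theorem subset_singleton_of_isIrreducible_of_open_trace {W : Scheme.{0}} {Y O : Set W} {y : W} (hO : IsOpen O) (hOY : O ∩ Y = {y})
    (hycl : IsClosed ({y} : Set W)) {T : Set W} (hT : IsIrreducible T) (hTY : T ⊆ Y) (hyT : y ∈ T) : T ⊆ {y} := by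
  have hdense := subset_closure_inter_of_isPreirreducible_of_isOpen hT.isPreirreducible hO ⟨y, hyT, by
    have : y ∈ O ∩ Y := hOY ▸ Set.mem_singleton y
    exact this.1⟩
  have hTO : T ∩ O ⊆ {y} := fun w hw => hOY ▸ ⟨hw.2, hTY hw.1⟩
  exact hdense.trans ((closure_mono hTO).trans (hycl.closure_eq.le))

include hX hreach in
/-- **In a finite near locus of closed points, `{y}` is an irreducible component of the stratum** for each of its points. [folklore] -/
theorem singleton_mem_componentsIn_of_finite (b : ℕ)
    (hU : ∃ U : Set (c b).W, IsOpen U ∧ (c b).pt ∈ U ∧ U ∩ Scheme.hsStratum (c b).W N ν ⊆ {(c b).pt}) (n : ℕ)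
    (hfin : ((upTower hc hRa hν h0 b).nearLocus N (c b).pt n).Finite)
    (hcl : ∀ y ∈ (upTower hc hRa hν h0 b).nearLocus N (c b).pt n, IsClosed ({y} : Set (c (b + n)).W))
    {y : (c (b + n)).W} (hy : y ∈ (upTower hc hRa hν h0 b).nearLocus N (c b).pt n) :
    ({y} : Set (c (b + n)).W) ∈ componentsIn (Scheme.hsStratum (c (b + n)).W N ν) := by
  obtain ⟨O, hO, hOY⟩ := exists_isOpen_inter_hsStratum_eq_singleton hc hRa hν h0 hX hreach b hU n hfin hcl hy
  refine mem_componentsIn_iff.mpr ⟨Set.singleton_subset_iff.mpr (nearLocus_subset_hsStratum hc hRa hν h0 hX hreach b n hy),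
    isIrreducible_singleton, fun T hTY hT hyT => ?_⟩
  exact subset_singleton_of_isIrreducible_of_open_trace hO hOY (hcl y hy) hT hTY (Set.singleton_subset_iff.mp hyT)

include hX hreach in
/-- **The components of the stratum inside a finite near locus of closed points are its singletons.** [folklore] -/
theorem exists_eq_singleton_of_mem_componentsIn_of_finite (b : ℕ)
    (hU : ∃ U : Set (c b).W, IsOpen U ∧ (c b).pt ∈ U ∧ U ∩ Scheme.hsStratum (c b).W N ν ⊆ {(c b).pt}) (n : ℕ)
    (hfin : ((upTower hc hRa hν h0 b).nearLocus N (c b).pt n).Finite)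
    (hcl : ∀ y ∈ (upTower hc hRa hν h0 b).nearLocus N (c b).pt n, IsClosed ({y} : Set (c (b + n)).W))
    {Z : Set (c (b + n)).W} (hZ : Z ∈ componentsIn (Scheme.hsStratum (c (b + n)).W N ν))
    (hZN : Z ⊆ (upTower hc hRa hν h0 b).nearLocus N (c b).pt n) :
    ∃ y : (c (b + n)).W, y ∈ (upTower hc hRa hν h0 b).nearLocus N (c b).pt n ∧ Z = {y} := by
  obtain ⟨y, hyZ⟩ := componentsIn.nonempty hZ
  refine ⟨y, hZN hyZ, ?_⟩
  by_contra hne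
  exact not_subset_of_mem_componentsIn_of_ne hZ (singleton_mem_componentsIn_of_finite hc hRa hν h0 hX hreach b hU n hfin hcl (hZN hyZ))
    (Ne.symm hne) (Set.singleton_subset_iff.mpr hyZ)

/-! ## §3. One label inside the near locus -/

include hX hreach in
/-- **ONE LABEL ⇒ A LABEL PART MEETING THE NEAR LOCUS CONTAINS IT.** If all irreducible components of `X_{b+n}(ν)` inside `N_n` carry the same
label and `Y^{(ℓ)} ∩ N_n ≠ ∅`, then `N_n ⊆ Y^{(ℓ)}` (so the marked point `x_{b+n} ∈ N_n` lies in `Y^{(ℓ)}`: a whole-part step meeting the near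
locus is GENUINE). [cite: CossartJannsenSaito2020, Rem. 6.29 (1), Def. 6.38 (iii)] -/
theorem nearLocus_subset_part_of_meets (b : ℕ)
    (hU : ∃ U : Set (c b).W, IsOpen U ∧ (c b).pt ∈ U ∧ U ∩ Scheme.hsStratum (c b).W N ν ⊆ {(c b).pt}) (n : ℕ)
    (hone : ∀ Z₁ ∈ componentsIn (Scheme.hsStratum (c (b + n)).W N ν), ∀ Z₂ ∈ componentsIn (Scheme.hsStratum (c (b + n)).W N ν),
      Z₁ ⊆ (upTower hc hRa hν h0 b).nearLocus N (c b).pt n → Z₂ ⊆ (upTower hc hRa hν h0 b).nearLocus N (c b).pt n →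
        (c (b + n)).L.label Z₁ = (c (b + n)).L.label Z₂)
    {ℓ : ℕ} (hmeet : ((c (b + n)).L.part (Scheme.hsStratum (c (b + n)).W N ν) ℓ ∩ (upTower hc hRa hν h0 b).nearLocus N (c b).pt n).Nonempty) :
    (upTower hc hRa hν h0 b).nearLocus N (c b).pt n ⊆ (c (b + n)).L.part (Scheme.hsStratum (c (b + n)).W N ν) ℓ := by
  obtain ⟨z, hzP, hzN⟩ := hmeet
  obtain ⟨Z, hZ, hlab, hzZ⟩ := ((c (b + n)).L.mem_part_iff _ ℓ z).mp hzP
  have hZN : Z ⊆ (upTower hc hRa hν h0 b).nearLocus N (c b).pt n :=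
    component_subset_nearLocus_of_meets hc hRa hν h0 hX hreach b hU n hZ ⟨z, hzZ, hzN⟩
  intro w hw
  obtain ⟨Z', hZ', hwZ'⟩ := componentsIn.exists_mem (nearLocus_subset_hsStratum hc hRa hν h0 hX hreach b n hw)
  have hZ'N : Z' ⊆ (upTower hc hRa hν h0 b).nearLocus N (c b).pt n :=
    component_subset_nearLocus_of_meets hc hRa hν h0 hX hreach b hU n hZ' ⟨w, hwZ', hw⟩
  exact ((c (b + n)).L.mem_part_iff _ ℓ w).mpr ⟨Z', hZ', (hone Z' hZ' Z hZ hZ'N hZN).trans hlab, hwZ'⟩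

include hX hreach in
/-- One label holds trivially when `N_n` is irreducible (it is the only component inside itself). [folklore] -/
theorem oneLabel_of_isIrreducible (b : ℕ)
    (hU : ∃ U : Set (c b).W, IsOpen U ∧ (c b).pt ∈ U ∧ U ∩ Scheme.hsStratum (c b).W N ν ⊆ {(c b).pt}) (n : ℕ)
    (hirr : IsIrreducible ((upTower hc hRa hν h0 b).nearLocus N (c b).pt n)) :
    ∀ Z₁ ∈ componentsIn (Scheme.hsStratum (c (b + n)).W N ν), ∀ Z₂ ∈ componentsIn (Scheme.hsStratum (c (b + n)).W N ν),
      Z₁ ⊆ (upTower hc hRa hν h0 b).nearLocus N (c b).pt n → Z₂ ⊆ (upTower hc hRa hν h0 b).nearLocus N (c b).pt n →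
        (c (b + n)).L.label Z₁ = (c (b + n)).L.label Z₂ := by
  intro Z₁ hZ₁ Z₂ hZ₂ h₁ h₂
  rw [eq_nearLocus_of_mem_componentsIn_of_isIrreducible hc hRa hν h0 hX hreach b hU n hirr hZ₁ h₁,
    eq_nearLocus_of_mem_componentsIn_of_isIrreducible hc hRa hν h0 hX hreach b hU n hirr hZ₂ h₂]

/-- A universally closed morphism maps closed points to closed points. [folklore] -/
theorem isClosed_singleton_base {W' W : Scheme.{0}} (f : W' ⟶ W) [UniversallyClosed f] {w : W'} (hw : IsClosed ({w} : Set W')) :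
    IsClosed ({f.base w} : Set W) := by
  have h := f.isClosedMap _ hw
  rw [Set.image_singleton] at h
  exact h

include hX hreach in
/-- **ONE LABEL PROPAGATES ALONG A STEP OF THE UNIT** under the dichotomy «`N` infinite irreducible, or a finite set of closed points» at both
stages: if the components inside `N_n` carry one label, so do the components inside `N_{n+1}`. (Irreducible `N_{n+1}`: one component. Finite
`N_{n+1}`: its components are closed points `{w}`; `{w}` dominates `{π w} ⊆ N_n`, which is a component iff `N_n` is finite — then all inherit the
one label of `N_n` — and is not when `N_n` is an infinite irreducible set — then all get the new label.) [cite: CossartJannsenSaito2020, Rem. 6.29 (1)] -/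
theorem oneLabel_succ (b : ℕ)
    (hU : ∃ U : Set (c b).W, IsOpen U ∧ (c b).pt ∈ U ∧ U ∩ Scheme.hsStratum (c b).W N ν ⊆ {(c b).pt}) (n : ℕ)
    (hDn : (((upTower hc hRa hν h0 b).nearLocus N (c b).pt n).Infinite ∧ IsIrreducible ((upTower hc hRa hν h0 b).nearLocus N (c b).pt n)) ∨
      (((upTower hc hRa hν h0 b).nearLocus N (c b).pt n).Finite ∧
        ∀ y ∈ (upTower hc hRa hν h0 b).nearLocus N (c b).pt n, IsClosed ({y} : Set (c (b + n)).W)))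
    (hDn1 : (((upTower hc hRa hν h0 b).nearLocus N (c b).pt (n + 1)).Infinite ∧
        IsIrreducible ((upTower hc hRa hν h0 b).nearLocus N (c b).pt (n + 1))) ∨
      (((upTower hc hRa hν h0 b).nearLocus N (c b).pt (n + 1)).Finite ∧
        ∀ y ∈ (upTower hc hRa hν h0 b).nearLocus N (c b).pt (n + 1), IsClosed ({y} : Set (c (b + (n + 1))).W)))
    (hone : ∀ Z₁ ∈ componentsIn (Scheme.hsStratum (c (b + n)).W N ν), ∀ Z₂ ∈ componentsIn (Scheme.hsStratum (c (b + n)).W N ν),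
      Z₁ ⊆ (upTower hc hRa hν h0 b).nearLocus N (c b).pt n → Z₂ ⊆ (upTower hc hRa hν h0 b).nearLocus N (c b).pt n →
        (c (b + n)).L.label Z₁ = (c (b + n)).L.label Z₂) :
    ∀ Z₁ ∈ componentsIn (Scheme.hsStratum (c (b + (n + 1))).W N ν), ∀ Z₂ ∈ componentsIn (Scheme.hsStratum (c (b + (n + 1))).W N ν),
      Z₁ ⊆ (upTower hc hRa hν h0 b).nearLocus N (c b).pt (n + 1) → Z₂ ⊆ (upTower hc hRa hν h0 b).nearLocus N (c b).pt (n + 1) →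
        (c (b + (n + 1))).L.label Z₁ = (c (b + (n + 1))).L.label Z₂ := by
  rcases hDn1 with ⟨-, hirr'⟩ | ⟨hfin', hcl'⟩
  · exact oneLabel_of_isIrreducible hc hRa hν h0 hX hreach b hU (n + 1) hirr'
  intro Z₁ hZ₁ Z₂ hZ₂ h₁ h₂
  obtain ⟨w₁, hw₁, rfl⟩ := exists_eq_singleton_of_mem_componentsIn_of_finite hc hRa hν h0 hX hreach b hU (n + 1) hfin' hcl' hZ₁ h₁
  obtain ⟨w₂, hw₂, rfl⟩ := exists_eq_singleton_of_mem_componentsIn_of_finite hc hRa hν h0 hX hreach b hU (n + 1) hfin' hcl' hZ₂ h₂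
  set f : (c (b + (n + 1))).W ⟶ (c (b + n)).W := (upTower hc hRa hν h0 b).π n with hf_def
  have hf : StepProjection R N ν (c (b + n)) (c (b + (n + 1))) f := Helpers.stepProjection_chainProj (shiftStep hc b) n
  haveI : IsLocallyNoetherian ((upTower hc hRa hν h0 b).X n) := (upTower hc hRa hν h0 b).ln n
  haveI : IsProper f := ((upTower hc hRa hν h0 b).isBlowup n).isProper
  -- `closure (π '' {w}) = {π w}` and `π w ∈ N_n`
  have himg : ∀ {w : (c (b + (n + 1))).W}, w ∈ (upTower hc hRa hν h0 b).nearLocus N (c b).pt (n + 1) →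
      closure (f.base '' {w}) = {f.base w} ∧ f.base w ∈ (upTower hc hRa hν h0 b).nearLocus N (c b).pt n := by
    intro w hw
    refine ⟨?_, image_nearLocus_succ_subset hc hRa hν h0 b n ⟨w, hw, rfl⟩⟩
    rw [Set.image_singleton]
    exact (isClosed_singleton_base f (hcl' w hw)).closure_eq
  obtain ⟨himg₁, hπw₁⟩ := himg hw₁
  obtain ⟨himg₂, hπw₂⟩ := himg hw₂
  rcases hDn with ⟨hinf, hirr⟩ | ⟨hfin, hcl⟩
  · -- `N_n` infinite irreducible: no closed point of it is a component, so both singletons get the new label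
    have hnew : ∀ {w : (c (b + (n + 1))).W}, w ∈ (upTower hc hRa hν h0 b).nearLocus N (c b).pt (n + 1) →
        (c (b + (n + 1))).L.label {w} = (c (b + n)).L.year + 1 := by
      intro w hw
      by_contra hne
      have hmem := hf.mem_componentsIn_of_label_ne hne
      rw [(himg hw).1] at hmem
      have heq := eq_nearLocus_of_mem_componentsIn_of_isIrreducible hc hRa hν h0 hX hreach b hU n hirr hmem
        (Set.singleton_subset_iff.mpr (himg hw).2)
      exact hinf (heq ▸ Set.finite_singleton _)
    exact (hnew hw₁).trans (hnew hw₂).symm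
  · -- `N_n` finite closed: `{π w}` is a component, the singletons inherit its label, and one label at `n` concludes
    have hc₁ := singleton_mem_componentsIn_of_finite hc hRa hν h0 hX hreach b hU n hfin hcl hπw₁
    have hc₂ := singleton_mem_componentsIn_of_finite hc hRa hν h0 hX hreach b hU n hfin hcl hπw₂
    have e₁ : (c (b + (n + 1))).L.label {w₁} = (c (b + n)).L.label {f.base w₁} := by
      rw [hf.label_eq_of_mem (by rw [himg₁]; exact hc₁), himg₁]
    have e₂ : (c (b + (n + 1))).L.label {w₂} = (c (b + n)).L.label {f.base w₂} := by
      rw [hf.label_eq_of_mem (by rw [himg₂]; exact hc₂), himg₂]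
    rw [e₁, e₂]
    exact hone _ hc₁ _ hc₂ (Set.singleton_subset_iff.mpr hπw₁) (Set.singleton_subset_iff.mpr hπw₂)

end Summit.ResolutionOfSingularities.ResolutionOfSingularities.Theorems.SigmaMaxModificationsCorridor3.Moving.Seg

end
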